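import Summits.QuantumFields.YangMills.Theorems.BalabanUVNodesN15KingModelGraphTreeLength

/-!
# BalabanUVNodes ∕ N15 — THE KING-MODEL RUNG (PART Α-h): «WE CAN USE THE EXPONENTIAL TREE DECAY IN (3.56) TO SUM OVER {w_l}» — the step (3.57): field
# insertions `A(w_1)⋯A(w_r)` with LINEARLY GROWING majorants ((3.45)) summed against a kernel with tree decay in `{y} ∪ {w_l}` cost a constant per insertion and
# half the decay rate: `|Σ_w A(w_1)⋯A(w_r)E(w)| ≤ B·(a(1 + 4r∕δ)Z)^r·exp[−(δ∕2)·treeLength{y}]` — generic, on part Α-b's tree length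
# (Track A, DAG node N15 = NE2; FAN-OUT v1.1 §N15 s3 «KING-MODEL RUNG … NE2's analogue DECIDED in the model»)

HONEST FRAMING.  Count-neutral (cell `pub-ymgap`, seat `pub-ymgap-dag-n15-e` g29; `--supports stmt-QuantumFields-27366 --as helper` = K3⁸
`SpineGivenEndpointR13SepCoPHV`).  TEMPLATE LITERATURE: C. King, *The U(1) Higgs model. I. The continuum limit*, Commun. Math. Phys. **102** (1986) 649–677
[King1986], p. 662: the deduction of Theorem 3.5 (3.39) from Proposition 3.6 (3.56) through (3.55) and (3.57).  Finite combinatorics ∕ real inequalities on a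
finite site sort with a pseudometric length; NO lattice, NO propagator, NO field: the kernel `E`, the insertions `A` and the one-point sum `Z` are hypotheses.
NOT Bałaban's `G(U)`; NOT a node discharge; nothing continuum ∕ ℝ⁴ ∕ OS ∕ mass-gap ∕ Clay.  0 `sorry`; standard axioms.  Text layer of pp. 661–662
(`paper:king1986-cmp102-king-u1-higgs-i` p0013–p0014) re-read by this seat 2026-08-29.

THE PRINT.  p. 662 [PDF 14], verbatim (text layer damaged at the displays): *«So if we denote by {H̃} the graphs obtained from H by all the previous expansions,
we can write E^{(k)}(H, A^{(k)}; {y_i}, {z_q}) = Σ_{H̃} Σ_{w_1,…,w_r ∈ T^{(k)}} A_k(w_1)⋯A_k(w_r) E^{(k)}(H̃; {y_i}, {z_q}, {w_l}). (3.55) … Proposition 3.6 …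
(3.56) To see that (3.39) follows from (3.56) consider … (3.57) Using the bounds (3.45) and recalling that x₀ ∈ □′, so |x₀ − y_i|, |x₀ − z_q| ≤ Cp(L^kε) each
i, q, we can use the exponential tree decay in (3.56) to sum over {w_l} and get (3.39) with n̄ = n₂ + 2r»*; p. 661 [PDF 13] (3.45): *«|A′(x)| ≤ Cp(L^kε)|x − x₀|»*.

READING (declared; ours).  The mechanism of «sum over {w_l}» in three letters: (i) the tree length of `U ∪ {w_l}` is at least that of `U` (monotone) AND at
least `|w_l − u₀|` for every `l` and any `u₀ ∈ U` (part Α-b `le_treeLength`), hence at least `½·treeLength U + (1∕2r)·Σ_l |w_l − u₀|`; (ii) a linearly growing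
weight costs half a rate: `(1 + ρ)e^{−cρ} ≤ (1 + 2∕c)e^{−(c∕2)ρ}`; (iii) the sum over `(w_1, …, w_r)` of a product factorises into the `r`-th power of the
one-point sum `Z = Σ_w e^{−(δ∕4r)|w − u₀|}`.  The field points may live in any finite sort `W` read into the site sort by `pt` (King: the unit lattice
`T^{(k)}`; in the rung, unit blocks read at their base points); `Z` is a hypothesis (a lattice sum (3.68) in any instance).

WHAT THIS FILE PROVES (namespace `Summit.QuantumFields.YangMills.BalabanUVNodes.N15KingModelRung.Graph`).
* §1 `connects_mono`, ★ `treeLength_mono`; ★ `one_add_mul_exp_neg_le` ((1 + ρ)e^{−cρ} ≤ (1 + 2∕c)e^{−(c∕2)ρ}, via `t·e^{−t} ≤ 1`); ★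
  `treeLength_union_ge_avg` (`treeLength(U ∪ pt(w)) ≥ ½·treeLength U + (1∕2r)·Σ_l ρ(pt w_l, u₀)`), ★★ `exp_treeLength_union_le` (the tree decay of `U ∪ {w_l}`
  splits into `exp[−(δ∕2)treeLength U]·Π_l exp[−(δ∕2r)ρ(pt w_l, u₀)]`); `sum_prod_eq_pow` (Σ over `w : Fin r → W` of `Π_l g(w_l)` = `(Σ g)^r`).
* §2 ★★★ **`sum_fieldPoints_treeDecay`** — THE STEP (3.57): for a pseudometric `ρ`, `u₀ ∈ U`, `r ≥ 1` field points in `W`, a kernel `|E(w)| ≤ B·exp[−δ·treeLength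
  ρ (U ∪ {pt w_l})]`, insertions `|A(w)| ≤ a(1 + ρ(pt w, u₀))` and the one-point sum `Σ_w exp[−(δ∕4r)ρ(pt w, u₀)] ≤ Z`:
  `|Σ_{w : Fin r → W} (Π_l A(w_l))·E(w)| ≤ B·exp[−(δ∕2)·treeLength ρ U]·(a·(1 + 4r∕δ)·Z)^r`.

HONEST SCOPE.  (a) Generic letters of (3.57) only; Theorem 3.5 (3.38)–(3.39) itself (the expansions (3.43)–(3.55), the counting of the graphs `H̃`, `n̄ = n₂ + 2r`)
is NOT typed; (3.45) enters as the hypothesis on `A`.  (b) Halving the rate and the constant `1 + 4r∕δ` are choices.  Locators: [King1986] (3.45) p.661, (3.55)–(3.57)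
p.662, p.660 (tree length).
-/

noncomputable section
namespace Summit.QuantumFields.YangMills.BalabanUVNodes.N15KingModelRung.Graph

open scoped BigOperators
open Finset

/-! ## §1 Letters: monotonicity of the tree length, linear weights against decay, the split of the tree decay, the factorisation -/

section Letters
variable {T : Type*}

/-- connecting is monotone in the edge set and antitone in the point set. [folklore] -/
theorem connects_mono {U U' : Finset T} (hUU : U ⊆ U') {E E' : Finset (T × T)} (hEE : E ⊆ E') (h : Connects U' E) : Connects U E' :=
  fun u hu v hv => eConn_mono hEE (h u (hUU hu) v (hUU hv))

variable [Fintype T]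

/-- ★ **THE TREE LENGTH GROWS WITH THE POINT SET**: `U ⊆ U′ ⇒ treeLength ρ U ≤ treeLength ρ U′` (a set connecting `U′` connects `U`).
[cite: King1986, p.660 («the length of the shortest tree graph connecting {u_i}»)] -/
theorem treeLength_mono (ρ : T → T → ℝ) {U U' : Finset T} (hUU : U ⊆ U') : treeLength ρ U ≤ treeLength ρ U' := by
  obtain ⟨E, hE, h⟩ := exists_connects_edgeLength_eq ρ U'
  rw [← h]
  exact treeLength_le_edgeLength ρ (connects_mono hUU (Subset.refl E) hE)

omit [Fintype T] in
/-- ★ **A LINEARLY GROWING WEIGHT COSTS HALF A RATE**: `(1 + ρ)·e^{−cρ} ≤ (1 + 2∕c)·e^{−(c∕2)ρ}` for `c > 0`, `ρ ≥ 0` — King's (3.45) `|A′(w)| ≤ Cp|w − x₀|`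
against the tree decay. [cite: King1986, (3.45) p.661, p.662 («Using the bounds (3.45) … we can use the exponential tree decay in (3.56) to sum over {w_l}»)] -/
theorem one_add_mul_exp_neg_le {c ρ : ℝ} (hc : 0 < c) (hρ : 0 ≤ ρ) :
    (1 + ρ) * Real.exp (-(c * ρ)) ≤ (1 + 2 / c) * Real.exp (-(c / 2 * ρ)) := by
  have hsplit : Real.exp (-(c * ρ)) = Real.exp (-(c / 2 * ρ)) * Real.exp (-(c / 2 * ρ)) := by
    rw [← Real.exp_add]; congr 1; ring
  have hkey : ρ * Real.exp (-(c / 2 * ρ)) ≤ 2 / c := by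
    -- `t·e^{−t} ≤ 1` (the tree's `Literature.NumberTheory.Automorphic.SelbergDecay.mul_exp_neg_le_one`; two lines, kept import-free)
    have h : c / 2 * ρ * Real.exp (-(c / 2 * ρ)) ≤ 1 := by
      have h1 := Real.add_one_le_exp (c / 2 * ρ)
      have hprod : Real.exp (c / 2 * ρ) * Real.exp (-(c / 2 * ρ)) = 1 := by rw [← Real.exp_add, add_neg_cancel, Real.exp_zero]
      nlinarith [Real.exp_pos (-(c / 2 * ρ))]
    have hc2 : 0 < c / 2 := by linarith
    calc ρ * Real.exp (-(c / 2 * ρ)) = (2 / c) * ((c / 2 * ρ) * Real.exp (-(c / 2 * ρ))) := by field_simp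
      _ ≤ (2 / c) * 1 := mul_le_mul_of_nonneg_left h (by positivity)
      _ = 2 / c := mul_one _
  have hE0 : 0 ≤ Real.exp (-(c / 2 * ρ)) := Real.exp_nonneg _
  have hE1 : Real.exp (-(c / 2 * ρ)) ≤ 1 := Real.exp_le_one_iff.2 (neg_nonpos.2 (by positivity))
  rw [hsplit]
  nlinarith [mul_le_mul_of_nonneg_right hkey hE0, mul_nonneg hρ hE0]

variable [DecidableEq T]

/-- ★ **THE TREE LENGTH OF `U ∪ {w_l}` IS AT LEAST HALF THAT OF `U` PLUS THE AVERAGE DISTANCE OF THE FIELD POINTS TO `u₀ ∈ U`** (pseudometric `ρ`, `r ≥ 1`):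
`treeLength(U ∪ {pt w_l}) ≥ ½·treeLength U + (1∕2r)·Σ_l ρ(pt w_l, u₀)` — monotonicity and part Α-b `le_treeLength`, averaged. [cite: King1986, p.660, p.662] -/
theorem treeLength_union_ge_avg {ρ : T → T → ℝ} (hρ0 : ∀ a b, 0 ≤ ρ a b) (hρr : ∀ a, ρ a a = 0) (hρs : ∀ a b, ρ a b = ρ b a)
    (hρt : ∀ a b c, ρ a c ≤ ρ a b + ρ b c) {U : Finset T} {u₀ : T} (hu₀ : u₀ ∈ U) {W : Type*} (pt : W → T) {r : ℕ} (hr : 1 ≤ r)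
    (w : Fin r → W) :
    treeLength ρ U / 2 + (∑ l, ρ (pt (w l)) u₀) / (2 * r) ≤ treeLength ρ (U ∪ univ.image (fun l => pt (w l))) := by
  set U' := U ∪ univ.image (fun l => pt (w l)) with hU'
  have h1 : treeLength ρ U ≤ treeLength ρ U' := treeLength_mono ρ subset_union_left
  have h2 : ∀ l, ρ (pt (w l)) u₀ ≤ treeLength ρ U' := fun l =>
    le_treeLength hρ0 hρr hρs hρt (mem_union_right _ (mem_image.2 ⟨l, mem_univ l, rfl⟩)) (mem_union_left _ hu₀)
  have h3 : ∑ l, ρ (pt (w l)) u₀ ≤ r * treeLength ρ U' := by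
    calc ∑ l, ρ (pt (w l)) u₀ ≤ ∑ _l : Fin r, treeLength ρ U' := sum_le_sum fun l _ => h2 l
      _ = r * treeLength ρ U' := by rw [sum_const, card_univ, Fintype.card_fin, nsmul_eq_mul]
  have hr0 : (0 : ℝ) < r := by exact_mod_cast hr
  have h4 : (∑ l, ρ (pt (w l)) u₀) / (2 * r) ≤ treeLength ρ U' / 2 := by
    rw [div_le_div_iff₀ (by positivity) (by norm_num)]
    nlinarith
  linarith

/-- ★★ **THE TREE DECAY OF `U ∪ {w_l}` SPLITS**: `exp[−δ·treeLength(U ∪ {pt w_l})] ≤ exp[−(δ∕2)·treeLength U]·Π_l exp[−(δ∕2r)·ρ(pt w_l, u₀)]` (`δ ≥ 0`).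
[cite: King1986, p.662 («we can use the exponential tree decay in (3.56) to sum over {w_l}»)] -/
theorem exp_treeLength_union_le {ρ : T → T → ℝ} (hρ0 : ∀ a b, 0 ≤ ρ a b) (hρr : ∀ a, ρ a a = 0) (hρs : ∀ a b, ρ a b = ρ b a)
    (hρt : ∀ a b c, ρ a c ≤ ρ a b + ρ b c) {U : Finset T} {u₀ : T} (hu₀ : u₀ ∈ U) {W : Type*} (pt : W → T) {r : ℕ} (hr : 1 ≤ r)
    {δ : ℝ} (hδ : 0 ≤ δ) (w : Fin r → W) :
    Real.exp (-(δ * treeLength ρ (U ∪ univ.image (fun l => pt (w l)))))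
      ≤ Real.exp (-(δ / 2 * treeLength ρ U)) * ∏ l, Real.exp (-(δ / (2 * r) * ρ (pt (w l)) u₀)) := by
  rw [← Real.exp_sum, ← Real.exp_add]
  refine Real.exp_le_exp.2 ?_
  have h := mul_le_mul_of_nonneg_left (treeLength_union_ge_avg hρ0 hρr hρs hρt hu₀ pt hr w) hδ
  have hr0 : (0 : ℝ) < r := by exact_mod_cast hr
  have e : ∑ l, -(δ / (2 * r) * ρ (pt (w l)) u₀) = -(δ * ((∑ l, ρ (pt (w l)) u₀) / (2 * r))) := by
    rw [sum_neg_distrib, ← mul_sum]; congr 1; field_simp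
  rw [e]
  nlinarith

omit [DecidableEq T] [Fintype T] in
/-- **THE SUM OVER THE FIELD POINTS OF A PRODUCT FACTORISES**: `Σ_{w : Fin r → W} Π_l g(w_l) = (Σ_w g(w))^r`. [folklore] -/
theorem sum_prod_eq_pow {W : Type*} [Fintype W] [DecidableEq W] (r : ℕ) (g : W → ℝ) :
    ∑ w : Fin r → W, ∏ l, g (w l) = (∑ x, g x) ^ r := by
  rw [← Fintype.prod_sum (fun (_ : Fin r) (x : W) => g x), prod_const, card_univ, Fintype.card_fin]

end Letters

/-! ## §2 The step (3.57): the field points summed against the tree decay -/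

section FieldPoints
variable {T : Type*} [Fintype T] [DecidableEq T]

/-- ★★★ **«WE CAN USE THE EXPONENTIAL TREE DECAY IN (3.56) TO SUM OVER {w_l}» — THE STEP (3.57).**  On a finite site sort with a pseudometric length `ρ`: a
point set `U` (King's `{y_i}, {z_q}`) with a marked point `u₀ ∈ U`, `r ≥ 1` field points ranging over a finite sort `W` read into the sites by `pt` (King's unit
lattice `T^{(k)}`), a KERNEL `E(w)` with tree decay in all the points, `|E(w)| ≤ B·exp[−δ·treeLength ρ (U ∪ {pt w_l})]` ((3.56)), INSERTIONS with linearly growing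
majorants `|A(w)| ≤ a·(1 + ρ(pt w, u₀))` ((3.45)), and the one-point sum `Σ_w exp[−(δ∕4r)·ρ(pt w, u₀)] ≤ Z` ((3.68)).  THEN
`|Σ_{w : Fin r → W} (Π_l A(w_l))·E(w)| ≤ B·exp[−(δ∕2)·treeLength ρ U]·(a·(1 + 4r∕δ)·Z)^r` — the tree decay of the remaining external points at half the rate, a
constant per insertion. [cite: King1986, (3.55)–(3.57) p.662 («we can use the exponential tree decay in (3.56) to sum over {w_l} and get (3.39)»), (3.45) p.661] -/
theorem sum_fieldPoints_treeDecay {ρ : T → T → ℝ} (hρ0 : ∀ a b, 0 ≤ ρ a b) (hρr : ∀ a, ρ a a = 0) (hρs : ∀ a b, ρ a b = ρ b a)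
    (hρt : ∀ a b c, ρ a c ≤ ρ a b + ρ b c) {U : Finset T} {u₀ : T} (hu₀ : u₀ ∈ U) {W : Type*} [Fintype W] [DecidableEq W] (pt : W → T)
    {r : ℕ} (hr : 1 ≤ r) {δ a B Z : ℝ} (hδ : 0 < δ) (ha : 0 ≤ a) (hB : 0 ≤ B)
    (E : (Fin r → W) → ℝ) (hE : ∀ w, |E w| ≤ B * Real.exp (-(δ * treeLength ρ (U ∪ univ.image (fun l => pt (w l))))))
    (A : W → ℝ) (hA : ∀ x, |A x| ≤ a * (1 + ρ (pt x) u₀))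
    (hZ : ∑ x : W, Real.exp (-(δ / (4 * r) * ρ (pt x) u₀)) ≤ Z) :
    |∑ w : Fin r → W, (∏ l, A (w l)) * E w| ≤ B * Real.exp (-(δ / 2 * treeLength ρ U)) * (a * (1 + 4 * r / δ) * Z) ^ r := by
  have hr0 : (0 : ℝ) < r := by exact_mod_cast hr
  set c : ℝ := δ / (2 * r) with hc
  have hc0 : 0 < c := by positivity
  have hc2 : c / 2 = δ / (4 * r) := by rw [hc]; field_simp; ring
  have hcK : 1 + 2 / c = 1 + 4 * r / δ := by rw [hc]; field_simp; ring
  -- the one-point weight after absorbing the linear growth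
  set g : W → ℝ := fun x => a * (1 + 4 * r / δ) * Real.exp (-(δ / (4 * r) * ρ (pt x) u₀)) with hg
  have hg0 : ∀ x, 0 ≤ g x := fun x => by positivity
  -- each insertion against its share of the decay
  have hins : ∀ x, |A x| * Real.exp (-(c * ρ (pt x) u₀)) ≤ g x := fun x => by
    have h1 := mul_le_mul_of_nonneg_right (hA x) (Real.exp_nonneg (-(c * ρ (pt x) u₀)))
    have h2 := one_add_mul_exp_neg_le hc0 (hρ0 (pt x) u₀)
    rw [hc2, hcK] at h2
    calc |A x| * Real.exp (-(c * ρ (pt x) u₀)) ≤ a * (1 + ρ (pt x) u₀) * Real.exp (-(c * ρ (pt x) u₀)) := h1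
      _ = a * ((1 + ρ (pt x) u₀) * Real.exp (-(c * ρ (pt x) u₀))) := by ring
      _ ≤ a * ((1 + 4 * r / δ) * Real.exp (-(δ / (4 * r) * ρ (pt x) u₀))) := mul_le_mul_of_nonneg_left h2 ha
      _ = g x := by rw [hg]; ring
  -- termwise
  have hterm : ∀ w : Fin r → W, |(∏ l, A (w l)) * E w| ≤ B * Real.exp (-(δ / 2 * treeLength ρ U)) * ∏ l, g (w l) := by
    intro w
    rw [abs_mul, abs_prod]
    have hsplit := exp_treeLength_union_le hρ0 hρr hρs hρt hu₀ pt hr hδ.le w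
    have hP0 : 0 ≤ ∏ l, |A (w l)| := prod_nonneg fun l _ => abs_nonneg _
    calc (∏ l, |A (w l)|) * |E w|
        ≤ (∏ l, |A (w l)|) * (B * (Real.exp (-(δ / 2 * treeLength ρ U)) * ∏ l, Real.exp (-(δ / (2 * r) * ρ (pt (w l)) u₀)))) :=
          mul_le_mul_of_nonneg_left ((hE w).trans (mul_le_mul_of_nonneg_left hsplit hB)) hP0
      _ = B * Real.exp (-(δ / 2 * treeLength ρ U)) * ∏ l, (|A (w l)| * Real.exp (-(c * ρ (pt (w l)) u₀))) := by
          rw [prod_mul_distrib, hc]; ring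
      _ ≤ B * Real.exp (-(δ / 2 * treeLength ρ U)) * ∏ l, g (w l) :=
          mul_le_mul_of_nonneg_left (prod_le_prod (fun l _ => mul_nonneg (abs_nonneg _) (Real.exp_nonneg _)) fun l _ => hins (w l))
            (mul_nonneg hB (Real.exp_nonneg _))
  -- sum and factorise
  refine (abs_sum_le_sum_abs _ _).trans ((sum_le_sum fun w _ => hterm w).trans ?_)
  rw [← mul_sum, sum_prod_eq_pow r g]
  refine mul_le_mul_of_nonneg_left ?_ (mul_nonneg hB (Real.exp_nonneg _))
  have hsum : ∑ x, g x ≤ a * (1 + 4 * r / δ) * Z := by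
    rw [hg, ← mul_sum]
    exact mul_le_mul_of_nonneg_left hZ (by positivity)
  exact pow_le_pow_left₀ (sum_nonneg fun x _ => hg0 x) hsum r

end FieldPoints

end Summit.QuantumFields.YangMills.BalabanUVNodes.N15KingModelRung.Graph

end
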